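import Summits.QuantumFields.YangMills.Theorems.BalabanUVNodesN20Knit

/-!
# BalabanUVNodes ∕ N20 knit, threshold form — node N20 = NE7b (`T4WeightBudget.RelWeightBound`) BY NAME at the tower records
# for EVERY origin beyond a NUMERIC threshold (no `∃ K₁`): what a record predicate must read to pin the carriers' origin

HONEST FRAMING.  Count-neutral kernel bookkeeping BY NAME, companion of `BalabanUVNodesN20Knit` (p409854) ∕ `…N20KnitDerived` (p410322)
of this seat's lineage (Track A, DAG node N20; cluster K5 «SpineMatching»).  NE7b is the cell `pub-balaban`'s OWN estimate — NOT PRINTED in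
[Bałaban 1983–89], NOT PROVED; the (α)-instance (Bałaban's K-step 𝐓∘𝐑 term recursion [Balaban1989LargeFieldII] (1.72) with the per-operation
factors (1.79)–(1.89) as binders, as a Lean object) is 0∕1 and «NC-NE7b-α» is UNRULED; no NODE 00 stage pins N20's carriers; nothing here is a
node discharge.  One finite four-torus programme at fixed ε; nothing continuum ∕ ℝ⁴ ∕ OS ∕ mass-gap ∕ Clay.  0 `sorry`, 0 `def`, standard axioms.

WHY THIS FILE.  Cluster K5's stub of record reads `S_N20 SRec := ∀ F D g₀ os S, SRec F D g₀ os S → RelWeightBound S.l₀ S.T S.A S.B S.Bad S.W`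
(dagwriter g74 `UVSplit` §K5 ∕ g80 `BalabanUVNodesClusters`): the carriers `S` — in particular their ORIGIN `S.K₀` (the number of steps at
cutoff `K = 0`) — are FIXED by the record predicate, and `RelWeightBound` asks `W K < 1` at EVERY cutoff.  The knit of record concludes
`∃ K₁ ≥ K₀, RelWeightBound` at the `K₁`-shifted tower carriers (`N20Knit.relWeightBound_of_towerExtraction_shifted` etc.), the origin being a
`Filter.eventually_atTop` witness of `T4WeightBudget.eventually_weightMajorant_lt` — not a term a definition can name without `Classical.choose`
on a theorem.  Here the origin is pinned by a NUMERIC SIDE CONDITION instead: for EVERY `K₁ ≥ K₀` with `V·rq^{K₁ − jhalf K₁} < 1` the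
`K₁`-shifted carriers satisfy `RelWeightBound` (the two-rate majorant `V·rq^{K − jhalf K}` is ANTITONE in `K`, so the inequality at the origin
is the inequality at every later cutoff), the side condition is met from some `K₁` on and at the EXPLICIT index
`⌊2·log V ∕ log rq⁻¹⌋₊ + 1`, and it is upward-closed — so a record predicate may read `S.K₀ := Sd.K₀ + ⌊2·log Sd.V ∕ log Sd.rq⁻¹⌋₊ + 1`
(«pins, not guards»: an honest, checkable pin rather than an existential).  The `∃`-forms of the knit of record are recovered in one line.

CONTENTS.  §1 (carrier-abstract) `sub_jhalf_mono` ∕ `weightMajorant_antitone` (the majorant is antitone along `jhalf`);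
`relWeightBound_shift_at` (the eventual∕indicator shape AT a given origin `K₁` is a plain `RelWeightBound` of the `K₁`-shifted families —
the tree's `CountThresholdExit.relWeightBound_shift_of_eventually` with the origin exposed); `relWeightBound_of_extractionLaws_threshold`
(two runs' `PinnedExtraction.ExtractionLaws` + the two-rate count from `K₁` on + the side condition at `K₁` ⇒ `RelWeightBound` at the
`K₁`-shifted EXACT carriers); `threshold_mono` (upward closure); `threshold_of_log` ∕ `threshold_at_floor` (the explicit index);
`exists_threshold` (non-vacuity).  §2 `relWeightBound_of_towerExtraction_threshold` — N20 BY NAME at the IR-103-1 record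
`TowerExtractionDataLWR` for EVERY admissible origin; `relWeightBound_of_towerExtraction_at_floor` (at the explicit origin) — the knit of record's `∃`-form
`N20Knit.relWeightBound_of_towerExtraction_shifted` is the special case `⟨K₁, hK, … Sd hK hthr⟩` at any witness of `exists_threshold`
(not restated: gate `dedup.landed`).  §3 the same at the IR-103-2 record
`TowerExtractionPricedDataLWR` given a displayed count, and one step deeper at ne6's IR-104-2 record `TowerExtractionStepDataLWR`
(H3^NE7b's display DERIVED from `NE7b.LocalConditionalStability.LocCondStability`) through `B16HistoryTowerExtractionEnd3.toPriced`.

WHAT HAS NO TREE PRODUCER (unchanged; reported, not claimed): an inhabitant, for Bałaban's tower, of the records' rows of Bałaban's KIND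
(`extractA ∕ extractB`, resp. `lcsA ∕ lcsB` — local conditional stability of the sacrificed action part in the history term's own state,
β-uniform: printed NOWHERE in relative form; print states the A_j-field factor ABSOLUTELY, [Balaban1989LargeFieldII] p. 383 l. 21–28) and of
the count rows; and the tower object itself ((A1c); owner WALL `ROW-NE7b-STATE.md` v1.76 §3).

Sources: T. Bałaban, CMP **122** (1989) 175–202 [Balaban1989LargeFieldI] p. 175, p. 177 (i)∕(ii), (0.3)–(0.5) pp. 176–177; CMP **122** (1989)
355–392 [Balaban1989LargeFieldII] (1.72) p. 379, (1.79)–(1.89) pp. 383–387; C. King, CMP **102** (1986) [King1986] (3.10)–(3.11) p. 656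
(printed MODEL of a weight bound carrying a positive power of the lattice spacing — what d = 4 lacks).  Nothing here is a claim about the
Yang–Mills mass gap.
-/

open Finset MeasureTheory
open Literature.MathematicalPhysics.QuantumFieldTheory.Balaban1983to89 T4PersistenceDictionary T4PersistentHistoryCount T4PrintedShapeBanking
open T4WeightBudget T4LiveClassFibration T4IndicatorShell T4MatchingAssembly T4MatchingClosure T4MatchingClosureSocket T4Continuum T4RenewalChains
open Summit.QuantumFields.BalabanUV.T4Continuum.CountSeamJunction Summit.QuantumFields.BalabanUV.T4Continuum.HistoryFlow
open Summit.QuantumFields.BalabanUV.T4Continuum.HistoryConstants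
open Summit.QuantumFields.BalabanUV.T4Continuum.HistorySocketTH Summit.QuantumFields.BalabanUV.T4Continuum.HistoryAssemblyTerms
open Summit.QuantumFields.BalabanUV.T4Continuum.HistoryAssemblyMult Summit.QuantumFields.BalabanUV.T4Continuum.HistoryAssemblyMultKey
open Summit.QuantumFields.BalabanUV.T4Continuum.HistoryRealiseCellsRunApexT3b Summit.QuantumFields.BalabanUV.T4Continuum.HistoryGenealogyRealise
open Summit.QuantumFields.BalabanUV.T4Continuum.HistoryGenealogyInstantiate Summit.QuantumFields.BalabanUV.T4Continuum.B16HistoryIndexedRepr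
open Summit.QuantumFields.BalabanUV.T4Continuum.B16HistoryIndexedTrunc Summit.QuantumFields.BalabanUV.T4Continuum.HistoryRealiseCellsRunAssemblyWTVSData
open Summit.QuantumFields.BalabanUV.T4Continuum.B16HistoryReprChain Summit.QuantumFields.BalabanUV.T4Continuum.B16HistoryReprInstance
open Summit.QuantumFields.BalabanUV.T4Continuum.NE7b.PinnedExtraction
open Summit.QuantumFields.BalabanUV.T4Continuum.B16HistoryTowerExtractionDataLWR
open Summit.QuantumFields.BalabanUV.T4Continuum.B16HistoryTowerExtractionEnd
open Summit.QuantumFields.BalabanUV.T4Continuum.B16HistoryTowerExtractionPricedDataLWR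
open Summit.QuantumFields.BalabanUV.T4Continuum.B16HistoryTowerExtractionStepDataLWR
open Summit.QuantumFields.BalabanUV.T4Continuum.B16HistoryTowerExtractionEnd3 (toPriced)
open Summit.QuantumFields.YangMills.BalabanUVNodes.N20Knit

noncomputable section

namespace Summit.QuantumFields.YangMills.BalabanUVNodes.N20KnitThreshold

set_option synthInstance.maxSize 1024

/-! ## §1 Carrier-abstract: the origin as a numeric side condition -/

section Abstract

variable {ι α α' : Type*} {l₀ : ℝ} {T : ℕ → Finset ι} {A B : ℕ → ℝ → ι → ℝ} {Bad Bad' : ℕ → ℝ → Finset ι}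
  {X : ℕ → Finset α} {Badx : ℕ → α → Finset ι} {q : ℕ → α → ℝ}
  {X' : ℕ → Finset α'} {Badx' : ℕ → α' → Finset ι} {q' : ℕ → α' → ℝ} {W : ℕ → ℝ}

/-- The number of OLD steps `K − jhalf K = ⌈K∕2⌉` (the exponent of the two-rate majorant; `T4RenewalChains.jhalf K = K ∕ 2`) is monotone
in the cutoff `K`. [folklore] -/
theorem sub_jhalf_mono {K K' : ℕ} (h : K ≤ K') : K - jhalf K ≤ K' - jhalf K' := by
  unfold jhalf; omega

/-- **THE TWO-RATE MAJORANT IS ANTITONE**: `V·r^{K′ − jhalf K′} ≤ V·r^{K − jhalf K}` for `K ≤ K′` (`0 ≤ r ≤ 1`, `0 ≤ V`) — so the side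
condition `V·r^{K₁ − jhalf K₁} < 1` at an origin `K₁` IS the condition `W K < 1` at every cutoff `K ≥ K₁`. [folklore] -/
theorem weightMajorant_antitone {r V : ℝ} (h0 : 0 ≤ r) (h1 : r ≤ 1) (hV : 0 ≤ V) {K K' : ℕ} (h : K ≤ K') :
    V * r ^ (K' - jhalf K') ≤ V * r ^ (K - jhalf K) :=
  mul_le_mul_of_nonneg_left (pow_le_pow_of_le_one h0 h1 (sub_jhalf_mono h)) hV

/-- **UPWARD CLOSURE of the side condition**: `V·r^{K₁ − jhalf K₁} < 1` at `K₁` gives it at every `K₁′ ≥ K₁` — a record predicate may pin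
ANY origin beyond the threshold. [folklore] -/
theorem threshold_mono {r V : ℝ} (h0 : 0 ≤ r) (h1 : r ≤ 1) (hV : 0 ≤ V) {K₁ K₁' : ℕ} (h : K₁ ≤ K₁')
    (hthr : V * r ^ (K₁ - jhalf K₁) < 1) : V * r ^ (K₁' - jhalf K₁') < 1 :=
  (weightMajorant_antitone h0 h1 hV h).trans_lt hthr

/-- **THE SIDE CONDITION FROM A LOGARITHMIC INEQUALITY**: `2·log V < K₁·log r⁻¹` (`0 < r < 1`, `0 ≤ V`) gives `V·r^{K₁ − jhalf K₁} < 1`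
(`K₁ − jhalf K₁ ≥ K₁∕2`, `T4RenewalChains.half_le_sub_jhalf`). [folklore] -/
theorem threshold_of_log {r V : ℝ} (h0 : 0 < r) (hr1 : r < 1) (hV : 0 ≤ V) {K₁ : ℕ}
    (hK : 2 * Real.log V < (K₁ : ℝ) * Real.log r⁻¹) : V * r ^ (K₁ - jhalf K₁) < 1 := by
  rcases hV.eq_or_lt with hV0 | hVpos
  · rw [← hV0, zero_mul]; exact one_pos
  -- `r^{K₁ − jhalf K₁} ≤ r^{K₁∕2}` as real powers
  have hle : r ^ (K₁ - jhalf K₁) ≤ r ^ ((1 / 2 : ℝ) * K₁) := by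
    rw [← Real.rpow_natCast]
    exact Real.rpow_le_rpow_of_exponent_ge h0 hr1.le (half_le_sub_jhalf K₁)
  have hpos : 0 < V * r ^ ((1 / 2 : ℝ) * K₁) := mul_pos hVpos (Real.rpow_pos_of_pos h0 _)
  have hlog : Real.log (V * r ^ ((1 / 2 : ℝ) * K₁)) < 0 := by
    rw [Real.log_mul hVpos.ne' (Real.rpow_pos_of_pos h0 _).ne', Real.log_rpow h0]
    have : Real.log r⁻¹ = -Real.log r := Real.log_inv r
    rw [this] at hK
    linarith
  have hlt : V * r ^ ((1 / 2 : ℝ) * K₁) < 1 := (Real.log_neg_iff hpos).1 hlog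
  exact (mul_le_mul_of_nonneg_left hle hV).trans_lt hlt

/-- **THE EXPLICIT INDEX**: at `K₁ := ⌊2·log V ∕ log r⁻¹⌋₊ + 1` the side condition holds (`0 < r < 1`, `0 ≤ V`; `log r⁻¹ > 0`), hence at every
larger origin (`threshold_mono`) — the term a record predicate can write for `S.K₀` without `Classical.choose`. [folklore] -/
theorem threshold_at_floor {r V : ℝ} (h0 : 0 < r) (hr1 : r < 1) (hV : 0 ≤ V) :
    V * r ^ ((⌊2 * Real.log V / Real.log r⁻¹⌋₊ + 1) - jhalf (⌊2 * Real.log V / Real.log r⁻¹⌋₊ + 1)) < 1 := by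
  have hlogr : 0 < Real.log r⁻¹ := Real.log_pos ((one_lt_inv₀ h0).2 hr1)
  refine threshold_of_log h0 hr1 hV ?_
  have h := Nat.lt_floor_add_one (2 * Real.log V / Real.log r⁻¹)
  rw [div_lt_iff₀ hlogr] at h
  exact_mod_cast h

/-- **NON-VACUITY of the side condition**: under `0 < r < 1`, `0 ≤ V` it holds at some `K₁ ≥ K₀` (indeed from some `K₁` on:
`T4WeightBudget.eventually_weightMajorant_lt` with `c = 1∕2`). [folklore] -/
theorem exists_threshold {r V : ℝ} (h0 : 0 < r) (hr1 : r < 1) (hV : 0 ≤ V) (K₀ : ℕ) :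
    ∃ K₁, K₀ ≤ K₁ ∧ V * r ^ (K₁ - jhalf K₁) < 1 := by
  obtain ⟨K₁, hK₁⟩ := Filter.eventually_atTop.mp
    (eventually_weightMajorant_lt h0 hr1 hV one_half_pos one_pos half_le_sub_jhalf)
  exact ⟨max K₀ K₁, le_max_left _ _, hK₁ _ (le_max_right _ _)⟩

/-- **THE EVENTUAL SHAPE AT A GIVEN ORIGIN IS A PLAIN `RelWeightBound` OF THE SHIFTED FAMILIES.**  A `RelWeightBound` whose bad classes are
`Bad′` EMPTIED below `K₁` and whose weight is ZEROED below `K₁` (`T4WeightBudget.relWeightBound_of_eventually`'s shape), with `Bad′ = Bad` from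
`K₁` on, is a `RelWeightBound` of the `K₁`-SHIFTED families with the classes `Bad` and the weight `W` themselves (the tree's
`CountThresholdExit.relWeightBound_shift_of_eventually`, origin exposed; `T4MatchingClosureSocket.relWeightBound_shift`). [folklore] -/
theorem relWeightBound_shift_at {K₁ : ℕ}
    (h : RelWeightBound l₀ T A B (fun K t => if K₁ ≤ K then Bad' K t else ∅) (Set.indicator {K | K₁ ≤ K} W))
    (hBB : ∀ K t, K₁ ≤ K → Bad' K t = Bad K t) :
    RelWeightBound l₀ (fun K => T (K₁ + K)) (fun K => A (K₁ + K)) (fun K => B (K₁ + K)) (fun K => Bad (K₁ + K))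
      fun K => W (K₁ + K) := by
  have hs := relWeightBound_shift K₁ h
  have h1 : ∀ K t, (if K₁ ≤ K₁ + K then Bad' (K₁ + K) t else ∅) = Bad (K₁ + K) t := fun K t => by
    rw [if_pos (Nat.le_add_right K₁ K), hBB _ t (Nat.le_add_right K₁ K)]
  have h2 : ∀ K, Set.indicator {K | K₁ ≤ K} W (K₁ + K) = W (K₁ + K) := fun K =>
    Set.indicator_of_mem (show K₁ + K ∈ {K | K₁ ≤ K} from Nat.le_add_right K₁ K) W
  exact
    { bad_subset := fun K t ht => by simpa only [h1 K t] using hs.bad_subset K t ht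
      nonneg := fun K => by simpa only [h2 K] using hs.nonneg K
      lt_one := fun K => by simpa only [h2 K] using hs.lt_one K
      summable := hs.summable.congr fun K => h2 K
      bad_left := fun K t ht => by simpa only [h1 K t, h2 K] using hs.bad_left K t ht
      bad_right := fun K t ht => by simpa only [h1 K t, h2 K] using hs.bad_right K t ht }

/-- **N20 AT THE `K₁`-SHIFTED EXACT CARRIERS FOR EVERY ORIGIN BEYOND THE THRESHOLD.**  Two runs' `PinnedExtraction.ExtractionLaws` over the
SAME term classes `T K` and bad classes `Bad′ K t` (run B's weights after node O's partial summation; pinned classes `X ∕ X′`, quotients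
`q ∕ q′` — the H3^NE7b display of [Balaban1989LargeFieldII] (1.79)–(1.89)'s KIND, RELATIVE), nonnegative weights, the cell's COUNT in two-rate
currency from `K₁` on (`Σ_x q K x ≤ V·r^{K − jhalf K}`, both runs, `0 < r < 1`, `0 ≤ V`), bad classes `Bad` agreeing with `Bad′` from `K₁` on,
and the NUMERIC SIDE CONDITION `V·r^{K₁ − jhalf K₁} < 1` give `RelWeightBound l₀` for the `K₁`-shifted families with the classes `Bad` and the
weight `V·r^{(K₁+K) − jhalf (K₁+K)}` VERBATIM — no `∃`.  Proof: `PinnedExtraction.relWeightBound_of_extraction` at `K₀ := K₁` (`W K < 1` for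
`K ≥ K₁` by `weightMajorant_antitone`; summability `T4WeightBudget.summable_weightMajorant`, `c = 1∕2`), then `relWeightBound_shift_at`.
Every analytic input is a hypothesis. [folklore] -/
theorem relWeightBound_of_extractionLaws_threshold {r V : ℝ} {K₁ : ℕ}
    (hA : ExtractionLaws l₀ T A Bad' X Badx q) (hB : ExtractionLaws l₀ T B Bad' X' Badx' q')
    (hA0 : ∀ K t, |t| ≤ l₀ → ∀ τ, 0 ≤ A K t τ) (hB0 : ∀ K t, |t| ≤ l₀ → ∀ τ, 0 ≤ B K t τ)
    (h0 : 0 < r) (hr1 : r < 1) (hV : 0 ≤ V)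
    (hmajA : ∀ K, K₁ ≤ K → ∑ x ∈ X K, q K x ≤ V * r ^ (K - jhalf K))
    (hmajB : ∀ K, K₁ ≤ K → ∑ x ∈ X' K, q' K x ≤ V * r ^ (K - jhalf K))
    (hBB : ∀ K t, K₁ ≤ K → Bad' K t = Bad K t) (hthr : V * r ^ (K₁ - jhalf K₁) < 1) :
    RelWeightBound l₀ (fun K => T (K₁ + K)) (fun K => A (K₁ + K)) (fun K => B (K₁ + K)) (fun K => Bad (K₁ + K))
      fun K => V * r ^ (K₁ + K - jhalf (K₁ + K)) :=
  relWeightBound_shift_at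
    (relWeightBound_of_extraction (W := fun K => V * r ^ (K - jhalf K)) hA hB hA0 hB0 hmajA hmajB
      (fun _ hK => threshold_mono h0.le hr1.le hV hK hthr)
      (summable_weightMajorant h0 hr1 hV one_half_pos half_le_sub_jhalf))
    hBB

/-- **… recovering the `∃`-form of the knit of record** (`N20Knit.exists_relWeightBound_shifted_of_extraction_majorant` at `jstar := jhalf`, with
the origin moreover `≥ K₀`): the side condition is met at some `K₁ ≥ K₀` (`exists_threshold`). [folklore] -/
theorem exists_relWeightBound_of_extractionLaws_threshold {r V : ℝ} (K₀ : ℕ)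
    (hA : ExtractionLaws l₀ T A Bad' X Badx q) (hB : ExtractionLaws l₀ T B Bad' X' Badx' q')
    (hA0 : ∀ K t, |t| ≤ l₀ → ∀ τ, 0 ≤ A K t τ) (hB0 : ∀ K t, |t| ≤ l₀ → ∀ τ, 0 ≤ B K t τ)
    (h0 : 0 < r) (hr1 : r < 1) (hV : 0 ≤ V)
    (hmajA : ∀ K, K₀ ≤ K → ∑ x ∈ X K, q K x ≤ V * r ^ (K - jhalf K))
    (hmajB : ∀ K, K₀ ≤ K → ∑ x ∈ X' K, q' K x ≤ V * r ^ (K - jhalf K))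
    (hBB : ∀ K t, K₀ ≤ K → Bad' K t = Bad K t) :
    ∃ K₁, K₀ ≤ K₁ ∧ RelWeightBound l₀ (fun K => T (K₁ + K)) (fun K => A (K₁ + K)) (fun K => B (K₁ + K))
      (fun K => Bad (K₁ + K)) fun K => V * r ^ (K₁ + K - jhalf (K₁ + K)) := by
  obtain ⟨K₁, hK, hthr⟩ := exists_threshold h0 hr1 hV K₀
  exact ⟨K₁, hK, relWeightBound_of_extractionLaws_threshold hA hB hA0 hB0 h0 hr1 hV (fun K hK1 => hmajA K (hK.trans hK1))
    (fun K hK1 => hmajB K (hK.trans hK1)) (fun K t hK1 => hBB K t (hK.trans hK1)) hthr⟩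

end Abstract

/-! ## §2 N20 BY NAME at the IR-103-1 record `TowerExtractionDataLWR` — for EVERY admissible origin, and at the explicit origin -/

section Tower

variable {F : T4Family} {G : Type*} [GaugeGroup G] [MeasurableSpace G] [HaarData G]
  {D : FiniteEpsData F G} {C : T4PrintedShapeBanking.Consts} {O : PrintedO1s} {θv : ℝ} {rr d n : ℕ} {hn : 0 < n}
  {g₀ : ℕ → ℝ} {os : List (ULoop F)} {cΛ M Φ β₀ : ℝ} {p₁ η η' κ κ₂ κᵥ : ℕ}
  {P : Type} [DecidableEq P] {X : ℕ → ℕ → Type} {𝒢 : (K j : ℕ) → GoodClass (X K j)}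
  [∀ K, MeasurableSpace (X K K)] {μ : (K : ℕ) → Measure (X K K)} [∀ K, IsFiniteMeasure (μ K)]

/-- **N20 · NE7b BY NAME AT THE TOWER RECORD OF THE RE-CUT (α) ROAD, FOR EVERY ORIGIN BEYOND THE THRESHOLD.**  For a record
`Sd : TowerExtractionDataLWR …` (datum `D`, tuned bare sequence `g₀`, loop string `os`; rows of Bałaban's KIND `extractA ∕ extractB` — in-edge
N13's (1.79)–(1.89) read per pinned old genealogy, RELATIVE — and the cell's `countA ∕ countB` with the record's constants `Sd.V`, `Sd.rq` —
in-edge N12's window — all HYPOTHESES carried by the record) and EVERY `K₁ ≥ Sd.K₀` with `Sd.V·Sd.rq^{K₁ − jhalf K₁} < 1`: the `K₁`-SHIFTED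
tower families — term classes `HIndex.termSet (skelFam Sd.T Sd.p₀) (K₁ + K)`, run A's M2-A weights, run B's `weightB … Sd.trunc`, the budget's
OWN saturated bad set, the weight `Sd.V·Sd.rq^{(K₁+K) − jhalf (K₁+K)}`, VERBATIM the carriers of `N20Knit.relWeightBound_of_towerExtraction_shifted`
— satisfy `T4WeightBudget.RelWeightBound Sd.l₀ …`.  No NE7c `shell`, NE7 `budget` or rate row is read. [folklore] -/
theorem relWeightBound_of_towerExtraction_threshold
    (Sd : TowerExtractionDataLWR D C O θv rr d n hn g₀ os cΛ M Φ β₀ p₁ η η' κ κ₂ κᵥ P X 𝒢 μ) {K₁ : ℕ} (hK : Sd.K₀ ≤ K₁)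
    (hthr : Sd.V * Sd.rq ^ (K₁ - jhalf K₁) < 1) :
    RelWeightBound Sd.l₀ (fun K => HIndex.termSet (skelFam Sd.T Sd.p₀) (K₁ + K))
      (fun _ t => Repr172R.weight μ (reprFam Sd.T Sd.p₀ Sd.ρ₀ Sd.hρ₀ Sd.h0 (fun _ _ => 1) (fun _ _ => one_pos)) t)
      (fun K => weightB μ (reprFam Sd.T Sd.p₀ Sd.ρ₀ Sd.hρ₀ Sd.h0 (fun _ _ => 1) (fun _ _ => one_pos)) Sd.trunc (K₁ + K))
      (fun K t => badOfClass (bstrOf Prod.fst (memA n F.L (Sd.𝒮.reading Sd.T Sd.p₀))) (HIndex.termSet (skelFam Sd.T Sd.p₀))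
          (fun K _ => badClasses Prod.fst (memA n F.L (Sd.𝒮.reading Sd.T Sd.p₀)) jhalf (HIndex.termSet (skelFam Sd.T Sd.p₀)) K)
          (K₁ + K) t)
      (fun K => Sd.V * Sd.rq ^ (K₁ + K - jhalf (K₁ + K))) :=
  relWeightBound_of_extractionLaws_threshold
    (Bad := fun K t => badOfClass (bstrOf Prod.fst (memA n F.L (Sd.𝒮.reading Sd.T Sd.p₀))) (HIndex.termSet (skelFam Sd.T Sd.p₀))
      (fun K _ => badClasses Prod.fst (memA n F.L (Sd.𝒮.reading Sd.T Sd.p₀)) jhalf (HIndex.termSet (skelFam Sd.T Sd.p₀)) K) K t)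
    (extractionLawsA Sd) (extractionLawsB Sd)
    (fun _ t _ τ => Repr172R.weight_nonneg μ _ t (fun _ _ _ => zero_le_one) τ)
    (fun K t _ τ => weightB_nonneg μ _ Sd.trunc K t (fun _ _ _ => zero_le_one) τ) Sd.hrq0 Sd.hrq1 Sd.hV
    (fun K hK1 => by simp only [if_pos (hK.trans hK1)]; exact Sd.countA K (hK.trans hK1))
    (fun K hK1 => by simp only [if_pos (hK.trans hK1)]; exact Sd.countB K (hK.trans hK1))
    (fun K t hK1 => by simp only [if_pos (hK.trans hK1)]) hthr

/-- **… AT THE EXPLICIT ORIGIN `Sd.K₀ + (⌊2·log Sd.V ∕ log Sd.rq⁻¹⌋₊ + 1)`** — a term in the record's constants only (`threshold_at_floor`,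
`threshold_mono`): the carriers a record predicate `SRec` can name for `S_N20` with no existential and no `Classical.choose`. [folklore] -/
theorem relWeightBound_of_towerExtraction_at_floor
    (Sd : TowerExtractionDataLWR D C O θv rr d n hn g₀ os cΛ M Φ β₀ p₁ η η' κ κ₂ κᵥ P X 𝒢 μ) :
    RelWeightBound Sd.l₀
      (fun K => HIndex.termSet (skelFam Sd.T Sd.p₀) (Sd.K₀ + (⌊2 * Real.log Sd.V / Real.log Sd.rq⁻¹⌋₊ + 1) + K))
      (fun _ t => Repr172R.weight μ (reprFam Sd.T Sd.p₀ Sd.ρ₀ Sd.hρ₀ Sd.h0 (fun _ _ => 1) (fun _ _ => one_pos)) t)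
      (fun K => weightB μ (reprFam Sd.T Sd.p₀ Sd.ρ₀ Sd.hρ₀ Sd.h0 (fun _ _ => 1) (fun _ _ => one_pos)) Sd.trunc
        (Sd.K₀ + (⌊2 * Real.log Sd.V / Real.log Sd.rq⁻¹⌋₊ + 1) + K))
      (fun K t => badOfClass (bstrOf Prod.fst (memA n F.L (Sd.𝒮.reading Sd.T Sd.p₀))) (HIndex.termSet (skelFam Sd.T Sd.p₀))
          (fun K _ => badClasses Prod.fst (memA n F.L (Sd.𝒮.reading Sd.T Sd.p₀)) jhalf (HIndex.termSet (skelFam Sd.T Sd.p₀)) K)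
          (Sd.K₀ + (⌊2 * Real.log Sd.V / Real.log Sd.rq⁻¹⌋₊ + 1) + K) t)
      (fun K => Sd.V * Sd.rq ^ (Sd.K₀ + (⌊2 * Real.log Sd.V / Real.log Sd.rq⁻¹⌋₊ + 1) + K -
        jhalf (Sd.K₀ + (⌊2 * Real.log Sd.V / Real.log Sd.rq⁻¹⌋₊ + 1) + K))) :=
  relWeightBound_of_towerExtraction_threshold Sd (Nat.le_add_right _ _)
    (threshold_mono Sd.hrq0.le Sd.hrq1.le Sd.hV (Nat.le_add_left _ _) (threshold_at_floor Sd.hrq0 Sd.hrq1 Sd.hV))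

end Tower

/-! ## §3 The IR-103-2 ∕ IR-104-2 records (H3^NE7b's display DERIVED from local conditional stability), the count displayed, threshold form -/

section Priced

variable {F : T4Family} {G : Type*} [GaugeGroup G] [MeasurableSpace G] [HaarData G]
  {D : FiniteEpsData F G} {C : T4PrintedShapeBanking.Consts} {O : PrintedO1s} {θv : ℝ} {rr d n : ℕ} {hn : 0 < n}
  {g₀ : ℕ → ℝ} {os : List (ULoop F)} {cΛ M Φ b₀ : ℝ} {p₁ η η' κ κ₂ κᵥ : ℕ}
  {P : Type} [DecidableEq P] {X : ℕ → ℕ → Type} {𝒢 : (K j : ℕ) → GoodClass (X K j)}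
  [∀ K, MeasurableSpace (X K K)] {μ : (K : ℕ) → Measure (X K K)} [∀ K, IsFiniteMeasure (μ K)]

/-- **N20 AT THE IR-103-2 RECORD GIVEN A DISPLAYED COUNT, FOR EVERY ORIGIN BEYOND THE THRESHOLD.**  The priced record's two extraction
displays (`N20Knit.extractionLawsA_priced ∕ extractionLawsB_priced`) + a COUNT of its quotients over the bad keys of the window in two-rate
currency from `Sp.K₀` on (`Σ_k Sp.qA K k ≤ V·rq^{K − jhalf K}`, `Σ_k Sp.qB K k ≤ V·rq^{K − jhalf K}`, `0 ≤ V`, `0 < rq < 1` — HYPOTHESES; on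
this record's own road the count is DERIVED from the price sentences inside the pinned `_rel` END, jointly with N19∕N21, see
`N20KnitDerived`) + EVERY `K₁ ≥ Sp.K₀` with `V·rq^{K₁ − jhalf K₁} < 1` ⇒ `RelWeightBound` at the `K₁`-shifted tower carriers, bad set and
weight VERBATIM (§2's currency). [folklore] -/
theorem relWeightBound_of_towerExtractionPriced_count_threshold
    (Sp : TowerExtractionPricedDataLWR D C O θv rr d n hn g₀ os cΛ M Φ b₀ p₁ η η' κ κ₂ κᵥ P X 𝒢 μ) {V rq : ℝ} {K₁ : ℕ}
    (hV : 0 ≤ V) (hrq0 : 0 < rq) (hrq1 : rq < 1)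
    (countA : ∀ K, Sp.K₀ ≤ K →
      ∑ k ∈ badGMems (memA n F.L (Sp.𝒮.reading Sp.T Sp.p₀)) jhalf (HIndex.termSet (skelFam Sp.T Sp.p₀))
          (kmemA n F.L hn (lt_of_lt_of_le (by norm_num) (two_le_L F)) (Sp.𝒮.reading Sp.T Sp.p₀)) K, Sp.qA K k ≤
        V * rq ^ (K - jhalf K))
    (countB : ∀ K, Sp.K₀ ≤ K →
      ∑ k ∈ badGMems (memA n F.L (Sp.𝒮.reading Sp.T Sp.p₀)) jhalf (HIndex.termSet (skelFam Sp.T Sp.p₀))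
          (kmemA n F.L hn (lt_of_lt_of_le (by norm_num) (two_le_L F)) (Sp.𝒮.reading Sp.T Sp.p₀)) K, Sp.qB K k ≤
        V * rq ^ (K - jhalf K))
    (hK : Sp.K₀ ≤ K₁) (hthr : V * rq ^ (K₁ - jhalf K₁) < 1) :
    RelWeightBound Sp.l₀ (fun K => HIndex.termSet (skelFam Sp.T Sp.p₀) (K₁ + K))
      (fun _ t => Repr172R.weight μ (reprFam Sp.T Sp.p₀ Sp.ρ₀ Sp.hρ₀ Sp.h0 (fun _ _ => 1) (fun _ _ => one_pos)) t)
      (fun K => weightB μ (reprFam Sp.T Sp.p₀ Sp.ρ₀ Sp.hρ₀ Sp.h0 (fun _ _ => 1) (fun _ _ => one_pos)) Sp.trunc (K₁ + K))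
      (fun K t => badOfClass (bstrOf Prod.fst (memA n F.L (Sp.𝒮.reading Sp.T Sp.p₀))) (HIndex.termSet (skelFam Sp.T Sp.p₀))
          (fun K _ => badClasses Prod.fst (memA n F.L (Sp.𝒮.reading Sp.T Sp.p₀)) jhalf (HIndex.termSet (skelFam Sp.T Sp.p₀)) K)
          (K₁ + K) t)
      (fun K => V * rq ^ (K₁ + K - jhalf (K₁ + K))) :=
  relWeightBound_of_extractionLaws_threshold
    (Bad := fun K t => badOfClass (bstrOf Prod.fst (memA n F.L (Sp.𝒮.reading Sp.T Sp.p₀))) (HIndex.termSet (skelFam Sp.T Sp.p₀))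
      (fun K _ => badClasses Prod.fst (memA n F.L (Sp.𝒮.reading Sp.T Sp.p₀)) jhalf (HIndex.termSet (skelFam Sp.T Sp.p₀)) K) K t)
    (extractionLawsA_priced Sp) (extractionLawsB_priced Sp)
    (fun _ t _ τ => Repr172R.weight_nonneg μ _ t (fun _ _ _ => zero_le_one) τ)
    (fun K t _ τ => weightB_nonneg μ _ Sp.trunc K t (fun _ _ _ => zero_le_one) τ) hrq0 hrq1 hV
    (fun K hK1 => by simp only [if_pos (hK.trans hK1)]; exact countA K (hK.trans hK1))
    (fun K hK1 => by simp only [if_pos (hK.trans hK1)]; exact countB K (hK.trans hK1))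
    (fun K t hK1 => by simp only [if_pos (hK.trans hK1)]) hthr

end Priced

section Step

variable {F : T4Family} {G : Type*} [GaugeGroup G] [MeasurableSpace G] [HaarData G]
  {D : FiniteEpsData F G} {C : T4PrintedShapeBanking.Consts} {O : PrintedO1s} {θv : ℝ} {rr d n : ℕ} {hn : 0 < n}
  {g₀ : ℕ → ℝ} {os : List (ULoop F)} {cΛ M Φ b₀ : ℝ} {p₁ η η' κ κ₂ κᵥ : ℕ}
  {P : Type} [DecidableEq P] {X : ℕ → ℕ → Type} {𝒢 : (K j : ℕ) → GoodClass (X K j)}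
  [∀ K j, MeasurableSpace (X K j)] {μ : (K j : ℕ) → Measure (X K j)} [∀ K, IsFiniteMeasure (μ K K)]

/-- **N20 ONE STEP DEEPER — AT ne6's IR-104-2 RECORD `TowerExtractionStepDataLWR`, GIVEN A DISPLAYED COUNT, FOR EVERY ORIGIN BEYOND THE
THRESHOLD.**  The record's rows per bad key along its key pattern — `pwA ∕ pwB : PointwiseExtraction …` ([Balaban1989LargeFieldI] (0.1) p. 175,
[Balaban1989LargeFieldII] p. 383) and **`lcsA ∕ lcsB : LocCondStability …`** (THE residual of Bałaban's KIND — [Balaban1989LargeFieldI]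
(0.3)–(0.5) pp. 176–177; NOT print's statement) — with the step-kernel identities and readings become the IR-103-2 record under
`B16HistoryTowerExtractionEnd3.toPriced` (derived quotients `exp Σ_{j<K} (b − a)`); with the count displayed AT THOSE QUOTIENTS and any origin
`K₁ ≥ Sd.K₀` past the numeric threshold: `RelWeightBound` at the `K₁`-shifted tower carriers, VERBATIM.  Every input a hypothesis; nothing of
Bałaban's asserted. [folklore] -/
theorem relWeightBound_of_towerExtractionStep_count_threshold
    (Sd : TowerExtractionStepDataLWR D C O θv rr d n hn g₀ os cΛ M Φ b₀ p₁ η η' κ κ₂ κᵥ P X 𝒢 μ) {V rq : ℝ} {K₁ : ℕ}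
    (hV : 0 ≤ V) (hrq0 : 0 < rq) (hrq1 : rq < 1)
    (countA : ∀ K, Sd.K₀ ≤ K →
      ∑ k ∈ badGMems (memA n F.L (Sd.𝒮.reading Sd.T Sd.p₀)) jhalf (HIndex.termSet (skelFam Sd.T Sd.p₀))
          (kmemA n F.L hn (lt_of_lt_of_le (by norm_num) (two_le_L F)) (Sd.𝒮.reading Sd.T Sd.p₀)) K, (toPriced Sd).qA K k ≤
        V * rq ^ (K - jhalf K))
    (countB : ∀ K, Sd.K₀ ≤ K →
      ∑ k ∈ badGMems (memA n F.L (Sd.𝒮.reading Sd.T Sd.p₀)) jhalf (HIndex.termSet (skelFam Sd.T Sd.p₀))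
          (kmemA n F.L hn (lt_of_lt_of_le (by norm_num) (two_le_L F)) (Sd.𝒮.reading Sd.T Sd.p₀)) K, (toPriced Sd).qB K k ≤
        V * rq ^ (K - jhalf K))
    (hK : Sd.K₀ ≤ K₁) (hthr : V * rq ^ (K₁ - jhalf K₁) < 1) :
    RelWeightBound Sd.l₀ (fun K => HIndex.termSet (skelFam Sd.T Sd.p₀) (K₁ + K))
      (fun _ t => Repr172R.weight (fun K => μ K K) (reprFam Sd.T Sd.p₀ Sd.ρ₀ Sd.hρ₀ Sd.h0 (fun _ _ => 1) (fun _ _ => one_pos)) t)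
      (fun K => weightB (fun K => μ K K) (reprFam Sd.T Sd.p₀ Sd.ρ₀ Sd.hρ₀ Sd.h0 (fun _ _ => 1) (fun _ _ => one_pos)) Sd.trunc
        (K₁ + K))
      (fun K t => badOfClass (bstrOf Prod.fst (memA n F.L (Sd.𝒮.reading Sd.T Sd.p₀))) (HIndex.termSet (skelFam Sd.T Sd.p₀))
          (fun K _ => badClasses Prod.fst (memA n F.L (Sd.𝒮.reading Sd.T Sd.p₀)) jhalf (HIndex.termSet (skelFam Sd.T Sd.p₀)) K)
          (K₁ + K) t)
      (fun K => V * rq ^ (K₁ + K - jhalf (K₁ + K))) :=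
  relWeightBound_of_towerExtractionPriced_count_threshold (toPriced Sd) hV hrq0 hrq1 countA countB hK hthr

end Step

end Summit.QuantumFields.YangMills.BalabanUVNodes.N20KnitThreshold

end
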